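import Literature.NumberTheory.GelbartRogawski1991.LocalDoubledUnitaryDatum
import HarnessLib

/-!
# The local degenerate principal series `I_v(s, χ_v)` of the doubled unitary group `H(F_v) = U(𝕍 ⊕ −𝕍)(F_v)`

Topic `NumberTheory/K2Lit` (Track B build stream 29, leaf D1 of the in-house road for Liu 2021 Thm. B.4 (1);
planner `hodgecm-mathlib-K2Liu-plan`, memo `K2/K2Liu-plan/g0/DEPMAP-PRICE-184nat.v1.K2Liu-plan-g0.md` §5;
local companion of ★ `K2Lit/SiegelEisensteinSeriesDoubled`). Definitions and proved lemmas only: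
**no `sorry`, no named fact, no instance, no notation.**

**Setting** = the tree's local doubled datum ★ `GelbartRogawski1991.UnitaryDualPair.LocalSplitting`
(`LocalDoubledUnitaryDatum`): `E/F` a quadratic extension of number fields, `c`, `δ` (`c δ = −δ`, `δ² = d`), a
finite place `v` of `F`, `T₀ ∈ M_n(F)` symmetric, `J^𝔻 = (T₀ ⊕ −T₀) ⊗ 1`, the local group
`H(F_v) = ★ UnitaryGroup.localPi E c (n + n) J^𝔻 v ≤ Π_{w ∣ v} GL_{2n}(E_w)`, its Siegel parabolic
`P_Δ(F_v)` = ★ `IsSiegelDelta` (stabiliser of the diagonal Lagrangian), `det_Δ` = ★ `detDelta … w h ∈ E_w` and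
`χ_v(det_Δ h) = ∏_{w ∣ v} χ_w(det_Δ h_w)` = ★ `chiDet` for a family `χ_w : E_wˣ →* ℂˣ` ([Kudla1994 §3],
[HarrisKudlaSweet1996 §1 (1.11)–(1.15)]). This file adds, for `s ∈ ℂ`:

* `absDetDelta h = |det_Δ h|_v := ∏_{w ∣ v} ‖det_Δ h_w‖_w` (normalised absolute values of the `E_w`);
* `localSiegelCharacter χ_v s h = χ_v(det_Δ h) · |det_Δ h|_v^{s + n/2}` — the character of `P_Δ(F_v)` inducing
  `I_v(s, χ_v) = Ind_{P_Δ(F_v)}^{H(F_v)} (χ_v |·|_{E_v}^s ∘ det_Δ)` (unitary normalisation; `δ_{P_Δ}^{1/2} = |det_Δ|^{n/2}`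
  for `H ≅ U(n, n)`, cf. ★ `LocalDoubledSiegelParabolicModularCharacter`: `Δ_{P_Δ}(p) = ‖det_Δ p‖` in rank one);
* `IsLocalSiegelSection χ_v s f` (`f(p h) = localSiegelCharacter χ_v s p · f(h)` for `p ∈ P_Δ(F_v)`),
  `IsSmooth f` (right-invariance under an OPEN subgroup of `H(F_v)` — `v` is non-archimedean), and the
  **degenerate principal series** `localDegPS χ_v s : Submodule ℂ (H(F_v) → ℂ)` of smooth Siegel sections
  (Kudla–Sweet 1997; Liu 2021 §B.3 `J_a(s, μᶜ)_v`; Harris–Kudla–Sweet 1996 §1 `I_n(s, χ)`).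

Standard (`K_v`-flat) families and the Siegel–Weil section `h ↦ ω_v(h)Φ(0) ∈ I_v(s₀, χ_v)` (★
`LocalDoubledTwistedSectionEigenlaw` gives its `P_Δ`-law at `s₀`) are the next files (#7 of the DEPMAP table).
References: S. Kudla, W. J. Sweet, Israel J. Math. 98 (1997) §1 (WANT acq-15194); M. Harris, S. Kudla, W. J. Sweet,
JAMS 9 (1996) §1 (WANT acq-04821); Y. Liu, Invent. Math. 228 (2022) App. B §B.3 p. 101.
-/

noncomputable section

open scoped Matrix
open NumberField IsDedekindDomain

namespace Literature.NumberTheory.K2Lit.LocalSiegelDoubled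

open Literature.NumberTheory.Automorphic Literature.NumberTheory.Automorphic.UnitaryGroup
open Literature.NumberTheory.GelbartRogawski1991.UnitaryDualPair.LocalSplitting

variable (F : Type) [Field F] [NumberField F] (E : Type) [Field E] [NumberField E] [Algebra F E]
  [Algebra.IsQuadraticExtension F E] (c : E ≃ₐ[F] E)
  {δ : E} (hcδ : c δ = -δ) (hδ : δ ≠ 0) {d : F} (hd : δ * δ = algebraMap F E d)
  (v : HeightOneSpectrum (𝓞 F)) (n : ℕ) {T₀ : Matrix (Fin n) (Fin n) F} (hT₀ : T₀.IsSymm)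
  {JD : Matrix (Fin (n + n)) (Fin (n + n)) E} (hJD : JD = (gramD F n T₀).map (algebraMap F E))

/-! ## 1. `|det_Δ h|_v` and the inducing character -/

/-- **`|det_Δ h|_v = ∏_{w ∣ v} ‖det_Δ h_w‖_w`** (normalised absolute values on the completions `E_w`; one factor at a
non-split `v`, two at a split `v`). [cite: HarrisKudlaSweet1996, §1 (1.15)] -/
def absDetDelta (h : UnitaryGroup.localPi E c (n + n) JD v) : ℝ :=
  ∏ w : UnitaryGroup.PlacesOver E v, ‖detDelta F E c v n w h‖

omit [Algebra.IsQuadraticExtension F E] in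
/-- `|det_Δ h|_v ≥ 0`. [cite: HarrisKudlaSweet1996, §1 (1.15)] -/
theorem absDetDelta_nonneg (h : UnitaryGroup.localPi E c (n + n) JD v) : 0 ≤ absDetDelta F E c v n h :=
  Finset.prod_nonneg fun _ _ => norm_nonneg _

/-- **`χ_v(det_Δ h) · |det_Δ h|_v^{s + n/2}`** — the character of the Siegel parabolic `P_Δ(F_v)` inducing the
degenerate principal series `I_v(s, χ_v)` in the unitary normalisation (Liu 2021 §B.3 «the normalized induced
representation Ind (μᶜ · |·|^s) ∘ det»; Harris–Kudla–Sweet 1996 §1 `I_n(s, χ)`).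
[cite: Liu2021, §B.3 p. 101] [cite: HarrisKudlaSweet1996, §1 (1.15)] -/
def localSiegelCharacter (χv : ∀ w : UnitaryGroup.PlacesOver E v, (w.1.adicCompletion E)ˣ →* ℂˣ) (s : ℂ)
    (h : UnitaryGroup.localPi E c (n + n) JD v) : ℂ :=
  ((chiDet F E c v n χv h : ℂˣ) : ℂ) * ((absDetDelta F E c v n h : ℂ) ^ (s + (n : ℂ) / 2))

/-! ## 2. Siegel sections, smoothness, `I_v(s, χ_v)` -/

/-- **Siegel sections**: `f(p h) = χ_v(det_Δ p)|det_Δ p|_v^{s+n/2} f(h)` for `p ∈ P_Δ(F_v)` (★ `IsSiegelDelta`).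
[cite: HarrisKudlaSweet1996, §1 (1.15)] [cite: Liu2021, §B.3 p. 101] -/
def IsLocalSiegelSection (χv : ∀ w : UnitaryGroup.PlacesOver E v, (w.1.adicCompletion E)ˣ →* ℂˣ) (s : ℂ)
    (f : UnitaryGroup.localPi E c (n + n) JD v → ℂ) : Prop :=
  ∀ p : UnitaryGroup.localPi E c (n + n) JD v, IsSiegelDelta F E c hcδ hδ hd v n hT₀ hJD p →
    ∀ h : UnitaryGroup.localPi E c (n + n) JD v, f (p * h) = localSiegelCharacter F E c v n χv s p * f h

/-- **Smooth** (= locally constant, `v` non-archimedean): right-invariant under some open subgroup of `H(F_v)`.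
[cite: HarrisKudlaSweet1996, §1 (1.15)] -/
def IsSmooth (f : UnitaryGroup.localPi E c (n + n) JD v → ℂ) : Prop :=
  ∃ U : OpenSubgroup (UnitaryGroup.localPi E c (n + n) JD v),
    ∀ h u : UnitaryGroup.localPi E c (n + n) JD v, u ∈ (U : Subgroup (UnitaryGroup.localPi E c (n + n) JD v)) →
      f (h * u) = f h

omit [Algebra.IsQuadraticExtension F E] in
/-- Constant functions are smooth. [cite: HarrisKudlaSweet1996, §1 (1.15)] -/
theorem isSmooth_const (a : ℂ) : IsSmooth F E c v n (JD := JD) (fun _ => a) :=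
  ⟨⊤, fun _ _ _ => rfl⟩

omit [Algebra.IsQuadraticExtension F E] in
/-- Smooth functions are closed under addition. [cite: HarrisKudlaSweet1996, §1 (1.15)] -/
theorem IsSmooth.add {f g : UnitaryGroup.localPi E c (n + n) JD v → ℂ} (hf : IsSmooth F E c v n f)
    (hg : IsSmooth F E c v n g) : IsSmooth F E c v n (f + g) := by
  obtain ⟨U, hU⟩ := hf
  obtain ⟨U', hU'⟩ := hg
  refine ⟨U ⊓ U', fun h u hu => ?_⟩
  have hu' : u ∈ (U : Subgroup _) ∧ u ∈ (U' : Subgroup _) := by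
    simpa [OpenSubgroup.coe_inf] using hu
  simp [Pi.add_apply, hU h u hu'.1, hU' h u hu'.2]

omit [Algebra.IsQuadraticExtension F E] in
/-- Smooth functions are closed under scalars. [cite: HarrisKudlaSweet1996, §1 (1.15)] -/
theorem IsSmooth.smul {f : UnitaryGroup.localPi E c (n + n) JD v → ℂ} (a : ℂ) (hf : IsSmooth F E c v n f) :
    IsSmooth F E c v n (a • f) := by
  obtain ⟨U, hU⟩ := hf
  exact ⟨U, fun h u hu => by simp [Pi.smul_apply, hU h u hu]⟩

/-- **The degenerate principal series `I_v(s, χ_v)`** of `H(F_v) = U(𝕍 ⊕ −𝕍)(F_v)`: smooth Siegel sections, a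
`ℂ`-subspace of functions on `H(F_v)` (the group acts by right translation — the operators come with the
intertwining ∕ section files). [cite: Liu2021, §B.3 p. 101] [cite: HarrisKudlaSweet1996, §1 (1.15)] -/
def localDegPS (χv : ∀ w : UnitaryGroup.PlacesOver E v, (w.1.adicCompletion E)ˣ →* ℂˣ) (s : ℂ) :
    Submodule ℂ (UnitaryGroup.localPi E c (n + n) JD v → ℂ) where
  carrier := {f | IsLocalSiegelSection F E c hcδ hδ hd v n hT₀ hJD χv s f ∧ IsSmooth F E c v n f}
  zero_mem' := ⟨fun p _ h => by simp, isSmooth_const F E c v n 0⟩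
  add_mem' {f g} hf hg :=
    ⟨fun p hp h => by rw [Pi.add_apply, Pi.add_apply, hf.1 p hp h, hg.1 p hp h, mul_add],
      IsSmooth.add F E c v n hf.2 hg.2⟩
  smul_mem' a {f} hf :=
    ⟨fun p hp h => by rw [Pi.smul_apply, Pi.smul_apply, hf.1 p hp h, smul_eq_mul, smul_eq_mul]; ring,
      IsSmooth.smul F E c v n a hf.2⟩

/-- Membership in `I_v(s, χ_v)`. [cite: HarrisKudlaSweet1996, §1 (1.15)] -/
theorem mem_localDegPS_iff (χv : ∀ w : UnitaryGroup.PlacesOver E v, (w.1.adicCompletion E)ˣ →* ℂˣ) (s : ℂ)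
    (f : UnitaryGroup.localPi E c (n + n) JD v → ℂ) :
    f ∈ localDegPS F E c hcδ hδ hd v n hT₀ hJD χv s ↔
      IsLocalSiegelSection F E c hcδ hδ hd v n hT₀ hJD χv s f ∧ IsSmooth F E c v n f :=
  Iff.rfl

/-- A **family of sections** `s ↦ f_s ∈ I_v(s, χ_v)` (before flatness ∕ holomorphy are imposed).
[cite: Liu2021, Lem. B.10 p. 102] -/
def IsLocalSectionFamily (χv : ∀ w : UnitaryGroup.PlacesOver E v, (w.1.adicCompletion E)ˣ →* ℂˣ)
    (f : ℂ → UnitaryGroup.localPi E c (n + n) JD v → ℂ) : Prop :=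
  ∀ s : ℂ, f s ∈ localDegPS F E c hcδ hδ hd v n hT₀ hJD χv s

end Literature.NumberTheory.K2Lit.LocalSiegelDoubled
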